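import Literature.NumberTheory.ComplexMultiplication.FiniteQAlgebraLatticeInvertibleClassesFinite
import HarnessLib

/-!
# `G([Λ_2]_ε) → G([Λ_1]_ε)`, `[L]_ε ↦ [Λ_1L]_ε`, is SURJECTIVE for orders `Λ_2 ⊆ Λ_1` of an ARBITRARY
# finite-dimensional commutative `ℚ`-algebra `A`, all its fibres have the size of its kernel, and
# `#G([Λ_2]_ε) = #G([Λ_1]_ε) · #ker` (Hertling–Larabi 2026 Thm. 8.2 (b), (e), (f) ∕ 2026b Thm. 5.12 (b)–(e)) —
# the general-`A` twin of `CMAlgebraLatticePicardExtensionSurjective` (which is `Y = L_1 ⊕ ⋯ ⊕ L_t` only)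

[topic NumberTheory/ComplexMultiplication] General-`A` series (namespace
`Literature.NumberTheory.ComplexMultiplication.FiniteQAlgebraLattice`); sequel of
`FiniteQAlgebraLatticeLocallyPrincipal` (Thm. 8.2 (b) Step 1 `exists_invertible_order_mul_eq`: for `L_1 ∈ G(Λ_1)`
there is `L_2 ∈ G(Λ_2)` with `Λ_1L_2 = L_1`; `order_mul_order_eq_of_le`), `FiniteQAlgebraLatticeLocalUnits`
(Lemma 8.1 (b) `div_self_order_mul_eq_of_le`, `units_smul_order_mul`), `FiniteQAlgebraLatticePowersInvertible`
(`G(Λ)` is closed under products, `mul_div_mul_eq_and_mul_inv_eq_of_invertible`),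
`FiniteQAlgebraLatticeWeakEquivalence` ∕ `…MetricDual` (`L⁻¹ ∈ G(Λ)`) and `FiniteQAlgebraLatticeInvertibleClassesFinite`
(`G([Λ]_ε)` is FINITE for every `A`, Rem. 9.3 (iii) — which replaces the `Y`-only Thm. 6.5 input
`finite_quot_pic_div_self_eq` of the `Y`-file and makes the counting statements available for nilpotent `A`).  Lane
`lit-hodgefound` (Track 2 foundations library), seat p19 generation 37, row g37-#10 (port of g32-#6).  THEOREMS
ONLY: no definition, no instance, no notation, no named fact (D-0026, net Literature debt `0`), no `sorry`.

VOCABULARY.  For an order `R`, `G(R)` is the subtype of lattices `M` with `IsFullLattice A M ∧ M / M = R ∧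
M * ((M / M) / M) = M / M`, and `G([R]_ε) = Pic(R)` is its `Quot` by `M ∼ M' :⟺ ∃ u ∈ A^{unit}, uM = M'` (the
spelling of `FiniteQAlgebraLatticeInvertibleClassesFinite`); all statements below spell these out.

## Source, VERBATIM

C. Hertling, K. Larabi, *Semigroups from full lattices in commutative ℚ-algebras*, arXiv:2602.14973 (2026)
[HertlingLarabi2026], held `paper:arxiv-2602.14973`.  §8 (chunks p0021–p0023): «**Lemma 8.1.** […] (b) Let `Λ_1`
and `Λ_2 ∈ 𝓛(A)` be two orders with `Λ_2 ⊊ Λ_1`. If `L ∈ G(Λ_2)` then `Λ_1L ∈ G(Λ_1)`. This leads to group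
homomorphisms `G(Λ_2) → G(Λ_1), L ↦ Λ_1L` (8.1), `G([Λ_2]_ε) → G([Λ_1]_ε), [L]_ε ↦ [Λ_1L]_ε` (8.2). […]
**Theorem 8.2.** […] (b) The following sequence is exact, `1 → ∏(Λ_2)_(p)^{unit} → ∏(Λ_1)_(p)^{unit} → G(Λ_2) →
G(Λ_1) → 1`. Especially, the group homomorphism in (8.1) is surjective. […] (e) The maps in the following
sequence are the natural ones, the sequence is exact,
`1 → Λ_2^{unit} → Λ_1^{unit} → ∏_{p∈P_0}(Λ_1)_(p)^{unit}/(Λ_2)_(p)^{unit} → G([Λ_2]_ε) → G([Λ_1]_ε) → 1`.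
Especially, the group homomorphism in (8.2) is surjective. (f) […] By Theorem 6.5 the groups `G([Λ_2]_ε)` and
`G([Λ_1]_ε)` are finite. The size of one of them can be calculated by the size of the other one with the
following formula, `|G([Λ_2]_ε)|/|G([Λ_1]_ε)| = |(Λ_1/C)^{unit}|/|(Λ_2/C)^{unit}| · 1/[Λ_1^{unit} : Λ_2^{unit}]`.
[…] *Proof of the Claim* [(e)]: Consider `L̃ ∈ G(Λ_2)` with `[L̃]_ε ∈ ker(G([Λ_2]_ε) → G([Λ_1]_ε))`. Then
`[Λ_1L̃]_ε = [Λ_1]_ε`, so an element `a ∈ A^{unit}` with `Λ_1L̃ = aΛ_1` exists. […]»  «**Remarks 8.3.** […] Then the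
Propositions (12.9) and (12.11) in [Ne99] are analogs of the parts (e) and (c) of Theorem 8.2. Theorem (12.12) in
[Ne99] is a special case of part (f) of Theorem 8.2. The surjectivity of the map in (8.1) for the case when `A`
is an algebraic number field is also proved in [DTZ62].»

C. Hertling, K. Larabi, *Conjugacy classes of regular integer matrices*, arXiv:2602.15748 (2026)
[HertlingLarabi2026b], held `paper:arxiv-2602.15748`, §5 Thm. 5.12 (chunk p0011): «**Theorem 5.12** (Ne99) [HL26].
Let `Λ_1` and `Λ_2` be two orders in `A` with `Λ_2 ⊊ Λ_1`. […] (b) If `L ∈ G(Λ_2)` then `Λ_1L ∈ G(Λ_1)`. This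
leads to group homomorphisms `G(Λ_2) → G(Λ_1), L ↦ Λ_1L` (5.19), `G([Λ_2]_ε) → G([Λ_1]_ε),
[L]_ε ↦ [Λ_1L]_ε` (5.20). (c) […] Especially, the group homomorphism in (5.19) is surjective. […] (d) […]
Especially, the group homomorphism in (5.20) is surjective. (e) […] By Theorem 5.3 the groups `G([Λ_2]_ε)` and
`G([Λ_1]_ε)` are finite. The size of one of them can be calculated by the size of the other one with the
following formula, `|G([Λ_2]_ε)|/|G([Λ_1]_ε)| = |(Λ_1/C)^{unit}|/|(Λ_2/C)^{unit}| […]`»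

## Contents (what is proved, and what is not)

* §1 (8.2) is well defined and SURJECTIVE on `ε`-classes: `quot_pic_order_mul_surjective` (from the lattice-level
  surjectivity `exists_invertible_order_mul_eq`), with the membership `order_mul_mem_pic` (Lemma 8.1 (b)).
* §2 `natCard_quot_pic_le`: `#G([Λ_1]_ε) ≤ #G([Λ_2]_ε)` for orders `Λ_2 ⊆ Λ_1` (both finite for every
  finite-dimensional `A`, Rem. 9.3 (iii) ∕ Thm. 6.5).
* §3 `mul_mem_pic`, `inv_mem_pic` (`G(Λ)` is a group), `natCard_fiber_quot_pic_eq`: every fibre of (8.2) is in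
  bijection with the kernel `{[K]_ε ∈ G([Λ_2]_ε) | Λ_1K = uΛ_1 for a unit u}` (translate by `[L_2]_ε` with
  `Λ_1L_2 = L_1`, divide by `L_2⁻¹`), and `natCard_quot_pic_eq_natCard_quot_pic_mul_natCard_ker`:
  **`#G([Λ_2]_ε) = #G([Λ_1]_ε) · #ker`** — the counting content of (e)–(f) — with the divisibility
  `natCard_quot_pic_dvd`.  NOT formalised here: the identification of the kernel with
  `∏(Λ_1)_(p)^{unit}/(Λ_2)_(p)^{unit}` modulo `Λ_1^{unit}` ((e)) and with `(Λ_1/C)^{unit}/(Λ_2/C)^{unit}` ((c), (f);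
  see `FiniteQAlgebraLatticeOrderExtensionKernel`, `FiniteQAlgebraLatticeConductorKernelBijection` for the kernel).

## References

* [HertlingLarabi2026] C. Hertling, K. Larabi, arXiv:2602.14973 (2026), §8 Lemma 8.1 (b), Thm. 8.2 (b), (e), (f),
  Rem. 8.3 (chunks p0021–p0023). [cite: HertlingLarabi2026, §8 Thm. 8.2 (b), (e), (f), chunks p0021–p0023]
* [HertlingLarabi2026b] C. Hertling, K. Larabi, arXiv:2602.15748 (2026), §5 Thm. 5.12 (b)–(e) (chunk p0011).
  [cite: HertlingLarabi2026b, §5 Thm. 5.12, chunk p0011]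
* [DadeTausskyZassenhaus1962] E. C. Dade, O. Taussky, H. Zassenhaus, Math. Ann. 148 (1962) 31–64 (surjectivity of
  `G(Λ_2) → G(Λ_1)` for a number field, as cited by [HertlingLarabi2026] Rem. 8.3). [cite: DadeTausskyZassenhaus1962, as cited by HertlingLarabi2026 Rem. 8.3]
* [NeukirchANT1999] J. Neukirch, *Algebraic Number Theory*, Grundlehren 322 (1999), I §12 Prop. (12.9), Thm. (12.12)
  (one field), as identified in [HertlingLarabi2026] Rem. 8.3. [cite: NeukirchANT1999, I §12 Prop. (12.9), Thm. (12.12)]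
-/

noncomputable section

open scoped Classical Pointwise
open Module Function Submodule

open Literature.NumberTheory.Automorphic (IsFullLattice mem_units_smul_submodule_iff)
open Literature.LinearAlgebra.Matrix.LatimerMacDuffeeSquarefree (equivalence_exists_units_smul)

namespace Literature.NumberTheory.ComplexMultiplication.FiniteQAlgebraLattice

section PicardExtension

variable {A : Type} [CommRing A] [Algebra ℚ A]

/-! ## §1 (8.2) on `ε`-classes: well defined and surjective -/

omit [Algebra ℚ A] in
/-- **LEMMA 8.1 (b): `Λ_1L ∈ G(Λ_1)` for `L ∈ G(Λ_2)`, orders `Λ_2 ⊆ Λ_1`** (`div_self_order_mul_eq_of_le`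
packaged with fullness, in the `G(R)`-subtype form). [cite: HertlingLarabi2026, §8 Lemma 8.1 (b) (8.1), chunk p0021]
[cite: HertlingLarabi2026b, §5 Thm. 5.12 (b), chunk p0011] -/
theorem order_mul_mem_pic {Λ₁ Λ₂ : Submodule ℤ A} (hΛ₁ : IsFullLattice A Λ₁)
    (h1 : (1 : A) ∈ Λ₁) (hΛ₁Λ₁ : Λ₁ * Λ₁ ≤ Λ₁) (h2 : (1 : A) ∈ Λ₂) (hle : Λ₂ ≤ Λ₁)
    (M : {M : Submodule ℤ A // IsFullLattice A M ∧ M / M = Λ₂ ∧ M * ((M / M) / M) = M / M}) :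
    IsFullLattice A (Λ₁ * M.1) ∧ (Λ₁ * M.1) / (Λ₁ * M.1) = Λ₁ ∧
      (Λ₁ * M.1) * (((Λ₁ * M.1) / (Λ₁ * M.1)) / (Λ₁ * M.1)) = (Λ₁ * M.1) / (Λ₁ * M.1) :=
  have h := div_self_order_mul_eq_of_le h1 hΛ₁Λ₁ h2 hle M.2.2.1 M.2.2.2
  ⟨isFullLattice_mul hΛ₁ M.2.1, h.1, h.2⟩

/-- **THEOREM 8.2 (b)/(e) ∕ 5.12 (c)/(d): the map (8.2) `G([Λ_2]_ε) → G([Λ_1]_ε)`, `[L]_ε ↦ [Λ_1L]_ε`, is SURJECTIVE**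
for orders `Λ_2 ⊆ Λ_1` of every `A` — every class `[L_1]_ε ∈ G([Λ_1]_ε)` is `[Λ_1L_2]_ε` for some `L_2 ∈ G(Λ_2)`
(indeed with `Λ_1L_2 = L_1`, `exists_invertible_order_mul_eq`). [cite: HertlingLarabi2026, §8 Thm. 8.2 (b), (e) («Especially, the group homomorphism in (8.2) is surjective»), chunks p0021, p0023]
[cite: HertlingLarabi2026b, §5 Thm. 5.12 (d), chunk p0011] [cite: DadeTausskyZassenhaus1962, as cited by HertlingLarabi2026 Rem. 8.3 (number-field case)] -/
theorem quot_pic_order_mul_surjective {Λ₁ Λ₂ : Submodule ℤ A} (hΛ₁ : IsFullLattice A Λ₁)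
    (h1 : (1 : A) ∈ Λ₁) (hΛ₁Λ₁ : Λ₁ * Λ₁ ≤ Λ₁) (hΛ₂ : IsFullLattice A Λ₂)
    (h2 : (1 : A) ∈ Λ₂) (hΛ₂Λ₂ : Λ₂ * Λ₂ ≤ Λ₂) (hle : Λ₂ ≤ Λ₁)
    (q : Quot (fun M M' : {M : Submodule ℤ A //
        IsFullLattice A M ∧ M / M = Λ₁ ∧ M * ((M / M) / M) = M / M} => ∃ u : Aˣ, u • M.1 = M'.1)) :
    ∃ M : {M : Submodule ℤ A // IsFullLattice A M ∧ M / M = Λ₂ ∧ M * ((M / M) / M) = M / M},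
      Quot.mk _ ⟨Λ₁ * M.1, order_mul_mem_pic hΛ₁ h1 hΛ₁Λ₁ h2 hle M⟩ = q := by
  induction q using Quot.ind with | mk L₁ => ?_
  obtain ⟨L₂, hL₂, hO₂, hinv₂, hmul⟩ :=
    exists_invertible_order_mul_eq hΛ₁Λ₁ hΛ₂ h2 hΛ₂Λ₂ hle L₁.2.1 L₁.2.2.1 L₁.2.2.2
  exact ⟨⟨L₂, hL₂, hO₂, hinv₂⟩, congrArg (Quot.mk _) (Subtype.ext hmul)⟩

/-! ## §2 `#G([Λ_1]_ε) ≤ #G([Λ_2]_ε)` -/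

/-- **`#G([Λ_1]_ε) ≤ #G([Λ_2]_ε)` for orders `Λ_2 ⊆ Λ_1`** of a finite-dimensional `A` — the Picard group of the
bigger order is a quotient of that of the smaller one ((8.2) is surjective; both are finite by Rem. 9.3 (iii) ∕
Thm. 6.5, `finite_quot_invertible`). [cite: HertlingLarabi2026, §8 Thm. 8.2 (e), (f) («the group homomorphism in (8.2) is surjective»; «the groups G([Λ_2]_ε) and G([Λ_1]_ε) are finite»), chunks p0021–p0023]
[cite: NeukirchANT1999, I §12 Prop. (12.9) (one field: `Pic(𝒪) → Pic(𝒪_K) → 0`)] -/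
theorem natCard_quot_pic_le [Module.Finite ℚ A] {Λ₁ Λ₂ : Submodule ℤ A} (hΛ₁ : IsFullLattice A Λ₁)
    (h1 : (1 : A) ∈ Λ₁) (hΛ₁Λ₁ : Λ₁ * Λ₁ ≤ Λ₁) (hΛ₂ : IsFullLattice A Λ₂)
    (h2 : (1 : A) ∈ Λ₂) (hΛ₂Λ₂ : Λ₂ * Λ₂ ≤ Λ₂) (hle : Λ₂ ≤ Λ₁) :
    Nat.card (Quot (fun M M' : {M : Submodule ℤ A //
        IsFullLattice A M ∧ M / M = Λ₁ ∧ M * ((M / M) / M) = M / M} => ∃ u : Aˣ, u • M.1 = M'.1)) ≤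
    Nat.card (Quot (fun M M' : {M : Submodule ℤ A //
        IsFullLattice A M ∧ M / M = Λ₂ ∧ M * ((M / M) / M) = M / M} => ∃ u : Aˣ, u • M.1 = M'.1)) := by
  haveI := finite_quot_invertible hΛ₂
  let φ : Quot (fun M M' : {M : Submodule ℤ A //
        IsFullLattice A M ∧ M / M = Λ₂ ∧ M * ((M / M) / M) = M / M} => ∃ u : Aˣ, u • M.1 = M'.1) →
      Quot (fun M M' : {M : Submodule ℤ A //
        IsFullLattice A M ∧ M / M = Λ₁ ∧ M * ((M / M) / M) = M / M} => ∃ u : Aˣ, u • M.1 = M'.1) :=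
    Quot.lift (fun M => Quot.mk _ ⟨Λ₁ * M.1, order_mul_mem_pic hΛ₁ h1 hΛ₁Λ₁ h2 hle M⟩)
      fun M M' ⟨u, hu⟩ => Quot.sound ⟨u, by
        change u • (Λ₁ * M.1) = Λ₁ * M'.1
        rw [← units_smul_order_mul, hu]⟩
  refine Nat.card_le_card_of_surjective φ fun q => ?_
  obtain ⟨M, hM⟩ := quot_pic_order_mul_surjective hΛ₁ h1 hΛ₁Λ₁ hΛ₂ h2 hΛ₂Λ₂ hle q
  exact ⟨Quot.mk _ M, hM⟩

/-! ## §3 The fibres of (8.2) are translates of its kernel; `#G([Λ_2]_ε) = #G([Λ_1]_ε) · #ker` -/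

omit [Algebra ℚ A] in
/-- `G(Λ)` is closed under products (Thm. 5.6 (c): `𝒪(L_1L_2) = 𝒪(L_1)𝒪(L_2)` and `L_1L_2` invertible for
invertible `L_1, L_2`), in the `G(R)`-subtype form. [cite: HertlingLarabi2026, §4 Thm. 4.3 (after (iv)) and §5 Thm. 5.6 (c), chunks p0007, p0012] -/
theorem mul_mem_pic {Λ : Submodule ℤ A}
    (K M : {M : Submodule ℤ A // IsFullLattice A M ∧ M / M = Λ ∧ M * ((M / M) / M) = M / M}) :
    IsFullLattice A (K.1 * M.1) ∧ (K.1 * M.1) / (K.1 * M.1) = Λ ∧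
      (K.1 * M.1) * (((K.1 * M.1) / (K.1 * M.1)) / (K.1 * M.1)) = (K.1 * M.1) / (K.1 * M.1) := by
  have hKi : K.1 * (Λ / K.1) = Λ := by
    have h := K.2.2.2
    rwa [K.2.2.1] at h
  have hMi : M.1 * (Λ / M.1) = Λ := by
    have h := M.2.2.2
    rwa [M.2.2.1] at h
  obtain ⟨hO, hinv⟩ := mul_div_mul_eq_and_mul_inv_eq_of_invertible K.2.2.1 hKi hMi
  refine ⟨isFullLattice_mul K.2.1 M.2.1, hO, ?_⟩
  rw [hO]
  exact hinv

/-- `G(Λ)` is closed under inverses `L⁻¹ = (L:L):L` (Thm. 5.6 (c): «`L⁻¹` is invertible with `𝒪(L⁻¹) = 𝒪(L)`»),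
in the `G(R)`-subtype form. [cite: HertlingLarabi2026, §5 Thm. 5.6 (c), chunk p0012] -/
theorem inv_mem_pic {Λ : Submodule ℤ A}
    (M : {M : Submodule ℤ A // IsFullLattice A M ∧ M / M = Λ ∧ M * ((M / M) / M) = M / M}) :
    IsFullLattice A ((M.1 / M.1) / M.1) ∧ ((M.1 / M.1) / M.1) / ((M.1 / M.1) / M.1) = Λ ∧
      ((M.1 / M.1) / M.1) * ((((M.1 / M.1) / M.1) / ((M.1 / M.1) / M.1)) / ((M.1 / M.1) / M.1)) =
        ((M.1 / M.1) / M.1) / ((M.1 / M.1) / M.1) := by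
  have hO : ((M.1 / M.1) / M.1) / ((M.1 / M.1) / M.1) = M.1 / M.1 := div_div_div_eq_of_mul_div_div_eq M.2.2.2
  refine ⟨isFullLattice_div (isFullLattice_div M.2.1 M.2.1) M.2.1, by rw [hO]; exact M.2.2.1, ?_⟩
  rw [hO, div_div_div_eq_self_of_mul_div_div_eq M.2.2.2, mul_comm]
  exact M.2.2.2

/-- **THEOREM 8.2 (e), counting form: every FIBRE of (8.2) `G([Λ_2]_ε) → G([Λ_1]_ε)` is in bijection with its
KERNEL** `{[K]_ε | uΛ_1K = Λ_1 for some u ∈ A^{unit}}` — for `L_1 ∈ G(Λ_1)` pick `L_2 ∈ G(Λ_2)` with `Λ_1L_2 = L_1`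
(Thm. 8.2 (b) Step 1); `[K]_ε ↦ [KL_2]_ε` is a bijection from the kernel onto the fibre over `[L_1]_ε` (inverse
`[M]_ε ↦ [ML_2⁻¹]_ε`). [cite: HertlingLarabi2026, §8 Thm. 8.2 (e) (exactness at G([Λ_2]_ε) and surjectivity; proof of the Claim), chunks p0021–p0023] -/
theorem natCard_fiber_quot_pic_eq {Λ₁ Λ₂ : Submodule ℤ A}
    (hΛ₁Λ₁ : Λ₁ * Λ₁ ≤ Λ₁) (hΛ₂ : IsFullLattice A Λ₂)
    (h2 : (1 : A) ∈ Λ₂) (hΛ₂Λ₂ : Λ₂ * Λ₂ ≤ Λ₂) (hle : Λ₂ ≤ Λ₁)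
    (L₁ : {M : Submodule ℤ A // IsFullLattice A M ∧ M / M = Λ₁ ∧ M * ((M / M) / M) = M / M}) :
    Nat.card {q : Quot (fun M M' : {M : Submodule ℤ A //
          IsFullLattice A M ∧ M / M = Λ₂ ∧ M * ((M / M) / M) = M / M} => ∃ u : Aˣ, u • M.1 = M'.1) //
      ∃ M : {M : Submodule ℤ A // IsFullLattice A M ∧ M / M = Λ₂ ∧ M * ((M / M) / M) = M / M},
        Quot.mk _ M = q ∧ ∃ u : Aˣ, u • (Λ₁ * M.1) = L₁.1} =
    Nat.card {q : Quot (fun M M' : {M : Submodule ℤ A //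
          IsFullLattice A M ∧ M / M = Λ₂ ∧ M * ((M / M) / M) = M / M} => ∃ u : Aˣ, u • M.1 = M'.1) //
      ∃ M : {M : Submodule ℤ A // IsFullLattice A M ∧ M / M = Λ₂ ∧ M * ((M / M) / M) = M / M},
        Quot.mk _ M = q ∧ ∃ u : Aˣ, u • (Λ₁ * M.1) = Λ₁} := by
  have hE := equivalence_exists_units_smul
    (fun M : Submodule ℤ A => IsFullLattice A M ∧ M / M = Λ₂ ∧ M * ((M / M) / M) = M / M)
  have hΛ₁Λ₂ : Λ₁ * Λ₂ = Λ₁ := order_mul_order_eq_of_le hΛ₁Λ₁ h2 hle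
  -- `L₂ ∈ G(Λ₂)` with `Λ₁L₂ = L₁`, and its inverse `I = L₂⁻¹`
  obtain ⟨L₂, hL₂, hO₂, hinv₂, hmul⟩ :=
    exists_invertible_order_mul_eq hΛ₁Λ₁ hΛ₂ h2 hΛ₂Λ₂ hle L₁.2.1 L₁.2.2.1 L₁.2.2.2
  let M₀ : {M : Submodule ℤ A // IsFullLattice A M ∧ M / M = Λ₂ ∧ M * ((M / M) / M) = M / M} :=
    ⟨L₂, hL₂, hO₂, hinv₂⟩
  let I : {M : Submodule ℤ A // IsFullLattice A M ∧ M / M = Λ₂ ∧ M * ((M / M) / M) = M / M} :=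
    ⟨(L₂ / L₂) / L₂, inv_mem_pic M₀⟩
  have hMI : L₂ * ((L₂ / L₂) / L₂) = Λ₂ := by rw [hinv₂, hO₂]
  have hmulΛ₂ : ∀ K : {M : Submodule ℤ A // IsFullLattice A M ∧ M / M = Λ₂ ∧ M * ((M / M) / M) = M / M},
      K.1 * Λ₂ = K.1 := fun K => by
    have h := div_self_mul_eq_self K.1
    rw [K.2.2.1, mul_comm] at h
    exact h
  -- translation by `[L₂]_ε`
  let τ : Quot (fun M M' : {M : Submodule ℤ A //
          IsFullLattice A M ∧ M / M = Λ₂ ∧ M * ((M / M) / M) = M / M} => ∃ u : Aˣ, u • M.1 = M'.1) →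
      Quot (fun M M' : {M : Submodule ℤ A //
          IsFullLattice A M ∧ M / M = Λ₂ ∧ M * ((M / M) / M) = M / M} => ∃ u : Aˣ, u • M.1 = M'.1) :=
    Quot.map (fun K => ⟨K.1 * L₂, mul_mem_pic K M₀⟩) fun K K' ⟨u, hu⟩ => ⟨u, by
      change u • (K.1 * L₂) = K'.1 * L₂
      rw [units_smul_mul, hu]⟩
  have hτ : ∀ K : {M : Submodule ℤ A // IsFullLattice A M ∧ M / M = Λ₂ ∧ M * ((M / M) / M) = M / M},
      τ (Quot.mk _ K) = Quot.mk _ ⟨K.1 * L₂, mul_mem_pic K M₀⟩ := fun K => rfl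
  -- `τ` maps the kernel into the fibre over `[L₁]_ε`
  have hinto : ∀ q, (∃ M : {M : Submodule ℤ A //
        IsFullLattice A M ∧ M / M = Λ₂ ∧ M * ((M / M) / M) = M / M},
        Quot.mk _ M = q ∧ ∃ u : Aˣ, u • (Λ₁ * M.1) = Λ₁) →
      ∃ M : {M : Submodule ℤ A // IsFullLattice A M ∧ M / M = Λ₂ ∧ M * ((M / M) / M) = M / M},
        Quot.mk _ M = τ q ∧ ∃ u : Aˣ, u • (Λ₁ * M.1) = L₁.1 := by
    rintro q ⟨K, rfl, u, hu⟩
    refine ⟨⟨K.1 * L₂, mul_mem_pic K M₀⟩, (hτ K).symm, u, ?_⟩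
    change u • (Λ₁ * (K.1 * L₂)) = L₁.1
    rw [← mul_assoc, units_smul_mul, hu, hmul]
  let τ' : {q : Quot (fun M M' : {M : Submodule ℤ A //
          IsFullLattice A M ∧ M / M = Λ₂ ∧ M * ((M / M) / M) = M / M} => ∃ u : Aˣ, u • M.1 = M'.1) //
      ∃ M : {M : Submodule ℤ A // IsFullLattice A M ∧ M / M = Λ₂ ∧ M * ((M / M) / M) = M / M},
        Quot.mk _ M = q ∧ ∃ u : Aˣ, u • (Λ₁ * M.1) = Λ₁} →
      {q : Quot (fun M M' : {M : Submodule ℤ A //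
          IsFullLattice A M ∧ M / M = Λ₂ ∧ M * ((M / M) / M) = M / M} => ∃ u : Aˣ, u • M.1 = M'.1) //
      ∃ M : {M : Submodule ℤ A // IsFullLattice A M ∧ M / M = Λ₂ ∧ M * ((M / M) / M) = M / M},
        Quot.mk _ M = q ∧ ∃ u : Aˣ, u • (Λ₁ * M.1) = L₁.1} :=
    fun x => ⟨τ x.1, hinto x.1 x.2⟩
  refine (Nat.card_congr (Equiv.ofBijective τ' ⟨fun x y hxy => ?_, fun y => ?_⟩)).symm
  · -- injective: `v(KL₂) = K'L₂` gives `vK = K'` after multiplying by `L₂⁻¹`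
    obtain ⟨K, hK, -⟩ := x.2
    obtain ⟨K', hK', -⟩ := y.2
    apply Subtype.ext
    have h : τ x.1 = τ y.1 := congrArg Subtype.val hxy
    rw [← hK, ← hK', hτ, hτ] at h
    obtain ⟨v, hv⟩ := hE.eqvGen_iff.1 (Quot.eqvGen_exact h)
    change v • (K.1 * L₂) = K'.1 * L₂ at hv
    rw [← hK, ← hK']
    refine Quot.sound ⟨v, ?_⟩
    have h2 := congrArg (· * ((L₂ / L₂) / L₂)) hv
    rwa [units_smul_mul, mul_assoc, mul_assoc, hMI, ← units_smul_mul, hmulΛ₂ K, hmulΛ₂ K'] at h2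
  · -- surjective: `[M]_ε` over `[L₁]_ε` is `τ[ML₂⁻¹]_ε`, and `[ML₂⁻¹]_ε` lies in the kernel
    obtain ⟨M, hM, u, hu⟩ := y.2
    refine ⟨⟨Quot.mk _ ⟨M.1 * ((L₂ / L₂) / L₂), mul_mem_pic M I⟩, ⟨M.1 * ((L₂ / L₂) / L₂), mul_mem_pic M I⟩,
      rfl, u, ?_⟩, ?_⟩
    · change u • (Λ₁ * (M.1 * ((L₂ / L₂) / L₂))) = Λ₁
      rw [← mul_assoc, units_smul_mul, hu, ← hmul, mul_assoc, hMI, hΛ₁Λ₂]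
    · apply Subtype.ext
      change τ (Quot.mk _ _) = y.1
      rw [hτ, ← hM]
      refine Quot.sound ⟨1, ?_⟩
      change (1 : Aˣ) • ((M.1 * ((L₂ / L₂) / L₂)) * L₂) = M.1
      rw [one_smul, mul_assoc, mul_comm ((L₂ / L₂) / L₂) L₂, hMI, hmulΛ₂ M]

/-- **THEOREM 8.2 (e)–(f) ∕ 5.12 (e), counting form: `#G([Λ_2]_ε) = #G([Λ_1]_ε) · #ker(G([Λ_2]_ε) → G([Λ_1]_ε))`**
for orders `Λ_2 ⊆ Λ_1` of every finite-dimensional commutative `ℚ`-algebra `A` — (8.2) is surjective and all its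
fibres have the size of the kernel `{[K]_ε | uΛ_1K = Λ_1 for some u ∈ A^{unit}}` («The size of one of them can be
calculated by the size of the other one»; HL's (f) further identifies the kernel:
`|ker| = |(Λ_1/C)^{unit}|/|(Λ_2/C)^{unit}| / [Λ_1^{unit} : Λ_2^{unit}]`, not formalised here).
[cite: HertlingLarabi2026, §8 Thm. 8.2 (e), (f) (8.10), chunks p0021–p0023] [cite: HertlingLarabi2026b, §5 Thm. 5.12 (e), chunk p0011]
[cite: NeukirchANT1999, I §12 Thm. (12.12) (one field), as identified by HertlingLarabi2026 Rem. 8.3] -/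
theorem natCard_quot_pic_eq_natCard_quot_pic_mul_natCard_ker [Module.Finite ℚ A] {Λ₁ Λ₂ : Submodule ℤ A}
    (hΛ₁ : IsFullLattice A Λ₁) (h1 : (1 : A) ∈ Λ₁) (hΛ₁Λ₁ : Λ₁ * Λ₁ ≤ Λ₁)
    (hΛ₂ : IsFullLattice A Λ₂) (h2 : (1 : A) ∈ Λ₂) (hΛ₂Λ₂ : Λ₂ * Λ₂ ≤ Λ₂) (hle : Λ₂ ≤ Λ₁) :
    Nat.card (Quot (fun M M' : {M : Submodule ℤ A //
        IsFullLattice A M ∧ M / M = Λ₂ ∧ M * ((M / M) / M) = M / M} => ∃ u : Aˣ, u • M.1 = M'.1)) =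
    Nat.card (Quot (fun M M' : {M : Submodule ℤ A //
        IsFullLattice A M ∧ M / M = Λ₁ ∧ M * ((M / M) / M) = M / M} => ∃ u : Aˣ, u • M.1 = M'.1)) *
    Nat.card {q : Quot (fun M M' : {M : Submodule ℤ A //
          IsFullLattice A M ∧ M / M = Λ₂ ∧ M * ((M / M) / M) = M / M} => ∃ u : Aˣ, u • M.1 = M'.1) //
      ∃ M : {M : Submodule ℤ A // IsFullLattice A M ∧ M / M = Λ₂ ∧ M * ((M / M) / M) = M / M},
        Quot.mk _ M = q ∧ ∃ u : Aˣ, u • (Λ₁ * M.1) = Λ₁} := by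
  haveI := finite_quot_invertible hΛ₂
  haveI := finite_quot_invertible hΛ₁
  letI := Fintype.ofFinite (Quot (fun M M' : {M : Submodule ℤ A //
      IsFullLattice A M ∧ M / M = Λ₁ ∧ M * ((M / M) / M) = M / M} => ∃ u : Aˣ, u • M.1 = M'.1))
  have hE₁ := equivalence_exists_units_smul
    (fun M : Submodule ℤ A => IsFullLattice A M ∧ M / M = Λ₁ ∧ M * ((M / M) / M) = M / M)
  have hE₂ := equivalence_exists_units_smul
    (fun M : Submodule ℤ A => IsFullLattice A M ∧ M / M = Λ₂ ∧ M * ((M / M) / M) = M / M)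
  -- the map (8.2)
  let φ : Quot (fun M M' : {M : Submodule ℤ A //
        IsFullLattice A M ∧ M / M = Λ₂ ∧ M * ((M / M) / M) = M / M} => ∃ u : Aˣ, u • M.1 = M'.1) →
      Quot (fun M M' : {M : Submodule ℤ A //
        IsFullLattice A M ∧ M / M = Λ₁ ∧ M * ((M / M) / M) = M / M} => ∃ u : Aˣ, u • M.1 = M'.1) :=
    Quot.lift (fun M => Quot.mk _ ⟨Λ₁ * M.1, order_mul_mem_pic hΛ₁ h1 hΛ₁Λ₁ h2 hle M⟩)
      fun M M' ⟨u, hu⟩ => Quot.sound ⟨u, by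
        change u • (Λ₁ * M.1) = Λ₁ * M'.1
        rw [← units_smul_order_mul, hu]⟩
  -- its fibre over `[L₁]_ε`, intrinsically
  have hfibre : ∀ (L₁ : {M : Submodule ℤ A //
      IsFullLattice A M ∧ M / M = Λ₁ ∧ M * ((M / M) / M) = M / M}) (q),
      φ q = Quot.mk _ L₁ ↔ ∃ M : {M : Submodule ℤ A //
          IsFullLattice A M ∧ M / M = Λ₂ ∧ M * ((M / M) / M) = M / M},
        Quot.mk _ M = q ∧ ∃ u : Aˣ, u • (Λ₁ * M.1) = L₁.1 := by
    intro L₁ q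
    induction q using Quot.ind with | mk M => ?_
    change Quot.mk _ ⟨Λ₁ * M.1, _⟩ = Quot.mk _ L₁ ↔ _
    constructor
    · intro h
      exact ⟨M, rfl, hE₁.eqvGen_iff.1 (Quot.eqvGen_exact h)⟩
    · rintro ⟨M', hM', u, hu⟩
      obtain ⟨v, hv⟩ := hE₂.eqvGen_iff.1 (Quot.eqvGen_exact hM')
      refine Quot.sound ⟨u * v⁻¹, ?_⟩
      change (u * v⁻¹) • (Λ₁ * M.1) = L₁.1
      change v • M'.1 = M.1 at hv
      rw [← hv, units_smul_order_mul, mul_smul, inv_smul_smul, hu]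
  have hfib : ∀ q₁, Nat.card {q // φ q = q₁} =
      Nat.card {q : Quot (fun M M' : {M : Submodule ℤ A //
            IsFullLattice A M ∧ M / M = Λ₂ ∧ M * ((M / M) / M) = M / M} => ∃ u : Aˣ, u • M.1 = M'.1) //
        ∃ M : {M : Submodule ℤ A // IsFullLattice A M ∧ M / M = Λ₂ ∧ M * ((M / M) / M) = M / M},
          Quot.mk _ M = q ∧ ∃ u : Aˣ, u • (Λ₁ * M.1) = Λ₁} := fun q₁ => by
    induction q₁ using Quot.ind with | mk L₁ => ?_
    rw [Nat.card_congr (Equiv.subtypeEquivRight (hfibre L₁)),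
      natCard_fiber_quot_pic_eq hΛ₁Λ₁ hΛ₂ h2 hΛ₂Λ₂ hle L₁]
  rw [Nat.card_congr (Equiv.sigmaFiberEquiv φ).symm, Nat.card_sigma, Finset.sum_congr rfl fun q₁ _ => hfib q₁,
    Finset.sum_const, Finset.card_univ, ← Nat.card_eq_fintype_card, smul_eq_mul]

/-- **COROLLARY (8.10) ∕ (5.23): `#G([Λ_1]_ε)` DIVIDES `#G([Λ_2]_ε)`** for orders `Λ_2 ⊆ Λ_1` of every
finite-dimensional commutative `ℚ`-algebra `A`. [cite: HertlingLarabi2026, §8 Thm. 8.2 (f) (8.10), chunk p0021]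
[cite: HertlingLarabi2026b, §5 Thm. 5.12 (e), chunk p0011] -/
theorem natCard_quot_pic_dvd [Module.Finite ℚ A] {Λ₁ Λ₂ : Submodule ℤ A} (hΛ₁ : IsFullLattice A Λ₁)
    (h1 : (1 : A) ∈ Λ₁) (hΛ₁Λ₁ : Λ₁ * Λ₁ ≤ Λ₁) (hΛ₂ : IsFullLattice A Λ₂)
    (h2 : (1 : A) ∈ Λ₂) (hΛ₂Λ₂ : Λ₂ * Λ₂ ≤ Λ₂) (hle : Λ₂ ≤ Λ₁) :
    Nat.card (Quot (fun M M' : {M : Submodule ℤ A //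
        IsFullLattice A M ∧ M / M = Λ₁ ∧ M * ((M / M) / M) = M / M} => ∃ u : Aˣ, u • M.1 = M'.1)) ∣
    Nat.card (Quot (fun M M' : {M : Submodule ℤ A //
        IsFullLattice A M ∧ M / M = Λ₂ ∧ M * ((M / M) / M) = M / M} => ∃ u : Aˣ, u • M.1 = M'.1)) :=
  Dvd.intro _ (natCard_quot_pic_eq_natCard_quot_pic_mul_natCard_ker hΛ₁ h1 hΛ₁Λ₁ hΛ₂ h2 hΛ₂Λ₂ hle).symm

end PicardExtension

end Literature.NumberTheory.ComplexMultiplication.FiniteQAlgebraLattice
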